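import Summits.PneNP.PneNP.Theorems.ConvexRankGatesLinAlgGateBlindDoorHost
import Summits.PneNP.PneNP.Theorems.ConvexRankGatesLinAlgGateBlindCommPermSmallDim
import Summits.PneNP.PneNP.Theorems.ConvexRankGatesLinAlgGateBlindSpanProgramSmallDim
import Summits.PneNP.PneNP.Theorems.ConvexRankGatesLinAlgGateBlindSpanChainCover

/-!
# Route ConvexRankGates, crux `LinAlgGateBlind` (stmt-PneNP-10681): UNCONDITIONAL doors — monotone circuits with group / span gates below the union-bound threshold do not compute `CLIQUE(m, ⌈m^{1/8}⌉)`

Support theorems for the crux (line `dnf-invariant-wide-gates-see-small-cliques`; vocabulary of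
`Theorems/ConvexRankGatesLinAlgGateBlindDefs.lean`). The door theorem `not_computes_clique_of_collapse`
(`…Theorems.ConvexRankGatesLinAlgGateBlindDoorHost`) turns every landed single-gate range `SGAt m P …` with a term
collapse into an unconditional lower bound for circuits over `{∧₂, ∨₂} ∪ P`-gates. Instances (all classes written
inline, gates monotone by syntax, unbounded fan-in, polynomially many gates):

* `not_computes_clique_of_isOver_commPerm` — commutative `PERM_d` gates with `log₂ d! ≤ m^{3/4}/2`
  (`sgAt_commPerm_of_fewPoints`);
* `not_computes_clique_of_isOver_spanGate_zmod` — monotone span programs over `𝔽_p` of dimension `D`,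
  `D log₂ p ≤ m^{3/4}/2` (`sgAt_spanGate_of_dim_le`);
* `not_computes_clique_of_isOver_spanGateOver` — monotone span programs over ANY division ring of dimension
  `D ≤ m^{11/16}/(8 log₂ m)` (`sgAt_spanGateOver_of_dim_le_rpow`).

(The `PERM_d` instance, `d log₂ d ≤ m^{11/16}/(8 log₂ m)`, is `not_computes_clique_of_isOver_perm`,
`…Theorems.ConvexRankGatesLinAlgGateBlindPermCircuitLowerBound`; the group-order instance follows the same way from
`sgAt_permOrder_of_logb_le_rpow` and `isTermGate_permOrder_collapse`.) In each case: for every `c`, eventually in `m`, no such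
circuit with `≤ m^c` gates computes `CLIQUE(m, ⌈m^{1/8}⌉)`. No new definitions. [folklore]
-/

-- `Summit.PneNP.PneNP.…` duplicates `PneNP` BY DESIGN (single-problem summit).
set_option linter.dupNamespace false

noncomputable section

namespace Summit.PneNP.PneNP.Theorems

open Finset Filter Literature.Computability.Complexity Razborov
open Summit.PneNP.PneNP.Cruxes.LinAlgGateBlind.DnfInvariantWideGatesSeeSmallCliques

/-- **Monotone circuits with commutative `PERM_d` gates, `log₂ d! ≤ m^{3/4}/2`, are blind to `CLIQUE(m, ⌈m^{1/8}⌉)`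
(unconditional).** Door theorem + `isTermGate_commPerm_collapse` + `sgAt_commPerm_of_fewPoints`. [folklore] -/
theorem not_computes_clique_of_isOver_commPerm : ∀ c : ℕ, ∀ᶠ m : ℕ in atTop, ∀ d : ℕ,
    Real.logb 2 (d.factorial) ≤ (m : ℝ) ^ (3 / 4 : ℝ) / 2 →
    ∀ C : Circuit (KEdge m), C.IsOver ({GateFn.and 2, GateFn.or 2} ∪
      {g | ∃ d', d' ≤ d ∧ ∃ (σ : Fin g.1 → Equiv.Perm (Fin d')) (τ : Equiv.Perm (Fin d')),
        (∀ i j, σ i * σ j = σ j * σ i) ∧ ∀ v, g.2 v = true ↔ τ ∈ Subgroup.closure (σ '' {i | v i = true})}) →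
      C.size ≤ m ^ c → ¬ C.Computes (cliqueFn m ⌈(m : ℝ) ^ (1 / 8 : ℝ)⌉₊) := by
  intro c
  filter_upwards [not_computes_clique_of_collapse c, sgAt_commPerm_of_fewPoints c] with m hm hP d hd C hC hsize
  refine hm _ _ (fun g hg => ?_) (fun g hg A hA => ?_) (hP d hd) C hC hsize
  · obtain ⟨d', -, σ, τ, -, h⟩ := Set.mem_setOf_eq ▸ hg
    exact monotone_of_closure_gate g σ τ h
  · exact isTermGate_commPerm_collapse m (lOf m) d g A hA hg

/-- **Monotone circuits with `𝔽_p`-span-program gates of dimension `D`, `D log₂ p ≤ m^{3/4}/2`, are blind to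
`CLIQUE(m, ⌈m^{1/8}⌉)` (unconditional).** Door theorem + `isTermGate_spanGate_collapse` + `sgAt_spanGate_of_dim_le`.
[folklore] -/
theorem not_computes_clique_of_isOver_spanGate_zmod : ∀ c : ℕ, ∀ᶠ m : ℕ in atTop, ∀ (p D : ℕ), p.Prime →
    (D : ℝ) * Real.logb 2 p ≤ (m : ℝ) ^ (3 / 4 : ℝ) / 2 →
    ∀ C : Circuit (KEdge m), C.IsOver ({GateFn.and 2, GateFn.or 2} ∪
      {g | ∃ (r : Fin g.1 → Fin D → ZMod p) (t : Fin D → ZMod p),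
        ∀ v, g.2 v = true ↔ t ∈ Submodule.span (ZMod p) (r '' {i | v i = true})}) →
      C.size ≤ m ^ c → ¬ C.Computes (cliqueFn m ⌈(m : ℝ) ^ (1 / 8 : ℝ)⌉₊) := by
  intro c
  filter_upwards [not_computes_clique_of_collapse c, sgAt_spanGate_of_dim_le c] with m hm hP p D hp hD C hC hsize
  refine hm _ _ (fun g hg => ?_) (fun g hg A hA => ?_) (hP p D hp hD) C hC hsize
  · obtain ⟨r, t, h⟩ := Set.mem_setOf_eq ▸ hg
    exact monotone_of_span_gate g r t h
  · exact isTermGate_spanGate_collapse m (lOf m) D g A hA hg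

/-- **Monotone circuits with span-program gates of dimension `D ≤ m^{11/16}/(8 log₂ m)` over ANY division ring are blind
to `CLIQUE(m, ⌈m^{1/8}⌉)` (unconditional).** Door theorem + `isTermGate_spanGate_collapse` +
`sgAt_spanGateOver_of_dim_le_rpow`. [folklore] -/
theorem not_computes_clique_of_isOver_spanGateOver : ∀ (F : Type) [DivisionRing F] (c : ℕ), ∀ᶠ m : ℕ in atTop,
    ∀ D : ℕ, (D : ℝ) ≤ (m : ℝ) ^ (11 / 16 : ℝ) / (8 * Real.logb 2 m) →
    ∀ C : Circuit (KEdge m), C.IsOver ({GateFn.and 2, GateFn.or 2} ∪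
      {g | ∃ (r : Fin g.1 → Fin D → F) (t : Fin D → F),
        ∀ v, g.2 v = true ↔ t ∈ Submodule.span F (r '' {i | v i = true})}) →
      C.size ≤ m ^ c → ¬ C.Computes (cliqueFn m ⌈(m : ℝ) ^ (1 / 8 : ℝ)⌉₊) := by
  intro F _ c
  filter_upwards [not_computes_clique_of_collapse c, sgAt_spanGateOver_of_dim_le_rpow F c] with m hm hP D hD C hC hsize
  refine hm _ _ (fun g hg => ?_) (fun g hg A hA => ?_) (hP D hD) C hC hsize
  · obtain ⟨r, t, h⟩ := Set.mem_setOf_eq ▸ hg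
    exact monotone_of_span_gate g r t h
  · exact isTermGate_spanGate_collapse m (lOf m) D g A hA hg

end Summit.PneNP.PneNP.Theorems

end
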